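import Literature.MathematicalPhysics.QuantumLattice.HubbardNNNHoppingWindowCertificateWardD4
import Literature.MathematicalPhysics.QuantumLattice.HubbardTorusGenericSectorCertificate
import Literature.MathematicalPhysics.QuantumLattice.HubbardTTPrimeTorusFamilyTransport
import HarnessLib

/-!
# SU(2)-Ward × affine-`D₄` window certificates for the `t–t'` Hubbard model: unconditional soundness
# (torus and thermodynamic limit)

HONEST FRAMING: first certified bounds; not a superconductivity verdict. This file proves NO number. It assembles
the three pieces of the SU(2)-Ward slot — the generic-sector torus engine
(`HubbardTorusGenericSectorCertificate.torus_minEnergyOn_div_ge_of_local_certificate_generic`), the Ward × `D₄`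
torus theorem in the full `2n`-particle sector (`HubbardNNNHoppingWindowCertificateWardD4.wardD4TorusCert_of_genericSectorTorusCert`)
and the torus-family ⇒ thermodynamic-limit transport (`HubbardTTPrimeTorusFamilyTransport.energyDensityTT'_ge_of_torus_family_bound`)
— into the two UNCONDITIONAL soundness statements a certificate reader needs:

* `groundEnergy_hubbardTorusTT'_div_ge_of_wardD4_window_certificate` — certificate ⇒ `c − Σ‖a‖ + μ((2nh)/L² − n) ≤
  groundEnergy (hubbardTorusTT' L t t' U) (2nh) / L²` for every large torus (binder list = the body of the Ventures
  crux-line statement `wardk.WardD4TorusCert`, item stmt-Ventures-21721 / 22024; closes it by `exact`);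
* `energyDensityTT'_ge_of_wardD4_window_certificate` — certificate ⇒ `c − Σ‖a‖ ≤ energyDensityTT' t t' U n` (`0 ≤ U`,
  `0 ≤ n < 2`; binder list = `wardk.WardD4WindowSound`; closes it by `exact`). This is the soundness theorem for Han's
  translation-invariant bootstrap with its FULL square-lattice constraint set INCLUDING the SU(2) Ward rows
  `ω([S^±, X]) = 0` — the constraint set of the symmetry-reduced (`D₄ × SU(2)`-highest-weight) `t–t'` programs.

Written by hub-lb-sym-eng-3 (team lb-sym). No summit statement is proved here; a certified bound is a number with a
certificate; nothing here predicts superconductivity.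

## References
* X. Han, *Quantum many-body bootstrap*, arXiv:2006.06002 (2020), §2–3. [cite: Han2020Bootstrap, §3]
* D. Ruelle, *Statistical Mechanics: Rigorous Results* (1969), §3.3–3.4 (thermodynamic limit). [cite: Ruelle1969, §3.3]
-/

noncomputable section

namespace Literature.MathematicalPhysics.QuantumLattice

open Matrix Finset HubbardWave0 Literature.Probability.LatticeModels
open Literature.MathematicalPhysics.QuantumManyBody.StateRelaxation
open scoped ComplexOrder BigOperators

/-! ### Unconditional forms (the generic-sector engine is `HubbardTorusGenericSectorCertificate`) -/

/-- **SU(2)-Ward × affine-`D₄` window certificate ⇒ energy per site of every large `t–t'` torus** — the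
unconditional form of `wardD4TorusCert_of_genericSectorTorusCert`, the generic-sector engine being
`torus_minEnergyOn_div_ge_of_local_certificate_generic`. Binder list = the body of the Ventures crux-line statement
`wardk.WardD4TorusCert` (closes by `exact`). [cite: Han2020Bootstrap, §3] -/
theorem groundEnergy_hubbardTorusTT'_div_ge_of_wardD4_window_certificate :
    ∀ (t t' U : ℝ) (L : ℕ) [NeZero L], 3 ≤ L →
    ∀ (nh : ℕ), nh ≤ Fintype.card (FermionTorus 2 L) →
    ∀ (n : ℝ) (Λ Λ' : Finset (Site 2)) (hΛ : Λ ⊆ Λ') (_h8 : thicken Λ 1 ⊆ Λ')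
      (h0 : thicken ({0} : Finset (Site 2)) 1 ⊆ Λ') (hz : (0 : Site 2) ∈ Λ')
      (_hInj : Set.InjOn (Torus.proj (d := 2) L) ↑(thicken Λ' 1))
      (μ : ℝ)
      (m : Type) (_ : Fintype m) (_ : DecidableEq m) (Λm : Matrix m m ℂ) (_hΛm : Λm.PosSemidef)
      (O : m → FermionOp Λ')
      (κ : Type) (s : Finset κ) (B : κ → FermionOp Λ)
      (ι : Type) (tt : Finset ι) (γ : ι → DihedralGroup 4) (wv : ι → Site 2)
      (hsh : ∀ l, d4ShiftSet (γ l) (wv l) Λ ⊆ Λ') (Y : ι → FermionOp Λ)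
      (ρ : Type) (u : Finset ρ) (b : ρ → ℂ) (cw : ρ → List (Orb (PolySite Λ') × Bool))
      (_hcw : ∀ j ∈ u, ladderCharge (cw j) ≠ 0 ∨ ladderSpinCharge (cw j) ≠ 0)
      (θ : Type) (wp : Finset θ) (Xp : θ → FermionOp Λ')
      (θ' : Type) (wm : Finset θ') (Xm : θ' → FermionOp Λ')
      (δ : Type) (ah : Finset δ) (dc : δ → ℝ) (V : δ → FermionOp Λ')
      (κ'' : Type) (w : Finset κ'') (a : κ'' → ℂ) (word : κ'' → List (Orb (PolySite Λ') × Bool))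
      (c : ℝ),
        fermionEmbed (PolySite.incl h0) ((hubbardTTPrimeFermionInteraction t t' U).meanEnergyObs 1) -
            (c : ℂ) • (1 : FermionOp Λ') -
            ((μ : ℝ) : ℂ) • (nAt 0 hz 0 + nAt 0 hz 1 - ((n : ℝ) : ℂ) • (1 : FermionOp Λ')) =
          gramForm Λm O +
            (∑ k ∈ s, ((hubbardTTPrimeFermionInteraction t t' U).localHamiltonian Λ' * fermionEmbed (PolySite.incl hΛ) (B k) -
                fermionEmbed (PolySite.incl hΛ) (B k) * (hubbardTTPrimeFermionInteraction t t' U).localHamiltonian Λ') +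
              ∑ l ∈ tt, (fermionEmbed (PolySite.incl (hsh l)) (fermionEmbed (PolySite.d4Emb (γ l) (wv l) Λ) (Y l)) -
                fermionEmbed (PolySite.incl hΛ) (Y l)) +
              ∑ j ∈ u, b j • ladderWord (cw j) +
              ∑ r ∈ wp, ((spinPlus : FermionOp Λ') * Xp r - Xp r * (spinPlus : FermionOp Λ')) +
              ∑ r ∈ wm, ((spinMinus : FermionOp Λ') * Xm r - Xm r * (spinMinus : FermionOp Λ'))) +
            (∑ m' ∈ ah, ((dc m' : ℝ) : ℂ) • ((V m')ᴴ - V m') + ∑ k ∈ w, a k • ladderWord (word k)) →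
      c - ∑ k ∈ w, ‖a k‖ + μ * ((((2 * nh : ℕ) : ℝ)) / (L : ℝ) ^ 2 - n) ≤
        groundEnergy (hubbardTorusTT' L t t' U) (2 * nh) / (L : ℝ) ^ 2 :=
  wardD4TorusCert_of_genericSectorTorusCert torus_minEnergyOn_div_ge_of_local_certificate_generic

/-- **SU(2)-Ward × affine-`D₄` window certificate ⇒ thermodynamic-limit energy density of the `t–t'` Hubbard model**:
with target density `n ∈ [0, 2)`, `0 ≤ U`, ONE density multiplier and the two SU(2)-Ward null families, the window
identity proves `c − Σₖ ‖aₖ‖ ≤ energyDensityTT' t t' U n`. This is the soundness statement for Han's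
translation-invariant bootstrap with its FULL constraint set INCLUDING the SU(2) Ward rows `ω([S^±, X]) = 0`, i.e.
for the symmetry-reduced (`[SP] = D₄ × SU(2)`-highest-weight) programs of record; binder list = the body of the
Ventures crux-line statement `wardk.WardD4WindowSound` (closes by `exact`). Limit by
`energyDensityTT'_ge_of_torus_family_bound`. [cite: Han2020Bootstrap, §3] -/
theorem energyDensityTT'_ge_of_wardD4_window_certificate :
    ∀ (t t' U : ℝ), 0 ≤ U → ∀ (n : ℝ), 0 ≤ n → n < 2 →
    ∀ (Λ Λ' : Finset (Site 2)) (hΛ : Λ ⊆ Λ') (_h8 : thicken Λ 1 ⊆ Λ')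
      (h0 : thicken ({0} : Finset (Site 2)) 1 ⊆ Λ') (hz : (0 : Site 2) ∈ Λ')
      (μ : ℝ)
      (m : Type) (_ : Fintype m) (_ : DecidableEq m) (Λm : Matrix m m ℂ) (_hΛm : Λm.PosSemidef)
      (O : m → FermionOp Λ')
      (κ : Type) (s : Finset κ) (B : κ → FermionOp Λ)
      (ι : Type) (tt : Finset ι) (γ : ι → DihedralGroup 4) (wv : ι → Site 2)
      (hsh : ∀ l, d4ShiftSet (γ l) (wv l) Λ ⊆ Λ') (Y : ι → FermionOp Λ)
      (ρ : Type) (u : Finset ρ) (b : ρ → ℂ) (cw : ρ → List (Orb (PolySite Λ') × Bool))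
      (_hcw : ∀ j ∈ u, ladderCharge (cw j) ≠ 0 ∨ ladderSpinCharge (cw j) ≠ 0)
      (θ : Type) (wp : Finset θ) (Xp : θ → FermionOp Λ')
      (θ' : Type) (wm : Finset θ') (Xm : θ' → FermionOp Λ')
      (δ : Type) (ah : Finset δ) (dc : δ → ℝ) (V : δ → FermionOp Λ')
      (κ'' : Type) (w : Finset κ'') (a : κ'' → ℂ) (word : κ'' → List (Orb (PolySite Λ') × Bool))
      (c : ℝ),
        fermionEmbed (PolySite.incl h0) ((hubbardTTPrimeFermionInteraction t t' U).meanEnergyObs 1) -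
            (c : ℂ) • (1 : FermionOp Λ') -
            ((μ : ℝ) : ℂ) • (nAt 0 hz 0 + nAt 0 hz 1 - ((n : ℝ) : ℂ) • (1 : FermionOp Λ')) =
          gramForm Λm O +
            (∑ k ∈ s, ((hubbardTTPrimeFermionInteraction t t' U).localHamiltonian Λ' * fermionEmbed (PolySite.incl hΛ) (B k) -
                fermionEmbed (PolySite.incl hΛ) (B k) * (hubbardTTPrimeFermionInteraction t t' U).localHamiltonian Λ') +
              ∑ l ∈ tt, (fermionEmbed (PolySite.incl (hsh l)) (fermionEmbed (PolySite.d4Emb (γ l) (wv l) Λ) (Y l)) -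
                fermionEmbed (PolySite.incl hΛ) (Y l)) +
              ∑ j ∈ u, b j • ladderWord (cw j) +
              ∑ r ∈ wp, ((spinPlus : FermionOp Λ') * Xp r - Xp r * (spinPlus : FermionOp Λ')) +
              ∑ r ∈ wm, ((spinMinus : FermionOp Λ') * Xm r - Xm r * (spinMinus : FermionOp Λ'))) +
            (∑ m' ∈ ah, ((dc m' : ℝ) : ℂ) • ((V m')ᴴ - V m') + ∑ k ∈ w, a k • ladderWord (word k)) →
      c - ∑ k ∈ w, ‖a k‖ ≤ ThermodynamicLimit.energyDensityTT' t t' U n := by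
  intro t t' U hU n hn0 hn2 Λ Λ' hΛ h8 h0 hz μ m i1 i2 Λm hΛm O κ s B ι tt γ wv hsh Y ρ u b cw hcw θ wp Xp
    θ' wm Xm δ ah dc V κ'' w a word c hcert
  exact energyDensityTT'_ge_of_torus_family_bound t t' hU hn0 hn2 (thicken Λ' 1)
    (fun L _ hL3 hInj nh hn _ => groundEnergy_hubbardTorusTT'_div_ge_of_wardD4_window_certificate t t' U L hL3 nh hn n
      Λ Λ' hΛ h8 h0 hz hInj μ m i1 i2 Λm hΛm O κ s B ι tt γ wv hsh Y ρ u b cw hcw θ wp Xp θ' wm Xm δ ah dc V κ'' w a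
      word c hcert)


end Literature.MathematicalPhysics.QuantumLattice

end
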